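import Summits.QuantumFields.YangMills.Theorems.UnitScaleTiltProp7TwistedDefectDampedLevelMasses
import Summits.QuantumFields.YangMills.Theorems.UnitScaleTiltProp7TwistedOneStepLinL1OfRegPr
import HarnessLib

/-!
# Route `UnitScaleTilt`, crux K1 «MinimiserStabilityRegPr» (stmt-QuantumFields-19200), route-R E′ (A′) «HCOW-VIA-Σ» (★★OWNER RULING g28-№13), package P-A2 «JOINT-Σ» —
# **F0″ ∘ F2″ (∘ F1″) AT THE MEMBER: THE SYMMETRIC CHART REMAINDER IS AN ℓ¹-DAMPED SUM OF ONE-STEP DEFECTS ∕ OF LEVEL MASSES WITH THE EXPLICIT DAMPING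
# `κ = L⁻² + 2·10¹⁵·L³·ε₀`** (px18 g3's ✓`Prop7CovLogTowerOfRegPr.l1_CmapTwS_le_damped_defects_of_regPr` and routeR-w6 g7's F0″∘F1″ seam
# ✓`Prop7TwistedDefectDampedLevelMasses.l1_CmapTwS_le_damped_levelMasses` with their one displayed analytic letter `hT` DISCHARGED by this seat's F2″-COV member row
# ✓`Prop7TwistedOneStepLinL1OfRegPr.sum_norm_fderiv_dbarChartField_apply_le_of_regPr`).

Cell `ym3-torus`, D-0154 (3c) twin-width seat `ym-routeR-w3` (gen 7); `--supports stmt-QuantumFields-19200 --as helper`, count-neutral, def-free.  YM₃ on T³ is a ladder rung (R3),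
NOT the Clay problem; nothing here is a claim about the stub, the crux, d = 4 or the mass gap.

WHAT THIS FILE PROVES (sorry-free).
* ★★★ **`l1_CmapTwS_le_damped_defects_of_regPr_damped`** — for `RegPr F n K ε₀ U₀`, `0 < e`, `10⁹L²e ≤ 1`, `10¹³L³ε₀ ≤ 1`, the formal towers `Fm`, `Lin` of ✓`Prop7CovLogTower` and every
  `X` with `‖X‖ < e·η`: `Σ_{c : PBond (F.P n) 0} ‖CmapTwS F n K h U₀ X c‖ ≤ Σ_{l<K−n} κ^{K−n−1−l}·Σ_{c'} ‖defect_l(Fm l X) c'‖` with **`κ := (L²)⁻¹ + 2·10¹⁵·L³·ε₀`** — no `hT`, no `κ`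
  hypothesis left; what remains displayed is F1″ (the one-step defect, px15 g3's ✓`sum_norm_chartField_sub_fderiv_apply_le_of_regPr`: `≤ 10⁹L⁴·Σ_b‖(Fm l X) b‖²` under the level sup
  window) and F3″ (the level masses of `Fm l X`), both stated about the SAME `Fm`; F4″ = ✓`Prop7JointRowOfLevelMassesQ.jointRow_currency_q` at `q := 1 + 2·10¹⁵L⁵ε₀`.
* ★★★ **`l1_CmapTwS_le_damped_levelMasses_damped`** — the same with F1″ priced in (routeR-w6 g7's seam ∘ px15 g3's member row): `Σ_c ‖CmapTwS X c‖ ≤ Σ_{l<K−n} κ^{K−n−1−l}·(10⁹L⁴·Σ_b ‖(Fm l X) b‖²)`,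
  `κ := (L²)⁻¹ + 2·10¹⁵·L³·ε₀` — after this the symmetric P-A2 chain displays ONLY F3″ (`Σ_b‖(Fm l X) b‖² ≤ A·L^{−l} + B·L^{l}`, px17 g3 via ✓`Prop7CovLogTower.logTower_eq_iterate`).
HONEST SCOPE.  A two-line composition; the window `10¹³L³ε₀ ≤ 1` (F2″'s) dominates px18's `10¹²L³ε₀ ≤ 1`.  Nothing of P-A2's JOINT row, hcoS, E′, EX or the crux is claimed.

References: T. Bałaban, CMP **98** (1985) 17–51 [Balaban1985Averaging] ((125)–(127) p.36, (150)–(152) p.40); CMP **102** (1985) 277–309 [Balaban1985Variational] ((44)–(46) p.285,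
(146) p.301); CMP **95** (1984) 17–40 [Balaban1984PropagatorsI] ((1.18)–(1.20) pp.19–20).
-/

set_option autoImplicit false

noncomputable section

open scoped BigOperators Matrix.Norms.L2Operator

namespace Summit.QuantumFields.YangMills.Theorems.Prop7CovLogTowerDampedOfRegPr

open NormedSpace
open Literature.MathematicalPhysics.QuantumFieldTheory.Balaban1983to89
open Literature.MathematicalPhysics.QuantumFieldTheory.Balaban1983to89.T3ContinuumYM3Torus
open T4Continuum BlockAveraging AveragingRT ExpMeanLog
open MatrixLog (mlog)
open B7Prop1Explicit (expUnit val_expUnit)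
open T3PrintedRegularMinimiser (RegPr)
open T3SectALandauChart (eta eta_pos bgUnits pos_of_regPr)
open Summit.QuantumFields.YangMills.Theorems.Prop8Chart (emlAvgU emlIterU)
open Summit.QuantumFields.YangMills.Theorems.Prop7SymAvgTwSym (dbarCovU CmapTwS)
open Summit.QuantumFields.YangMills.Theorems.Prop7CovLogTowerOfRegPr (l1_CmapTwS_le_damped_defects_of_regPr)
open Summit.QuantumFields.YangMills.Theorems.Prop7TwistedDefectDampedLevelMasses (l1_CmapTwS_le_damped_levelMasses)
open Summit.QuantumFields.YangMills.Theorems.Prop7TwistedOneStepLinL1OfRegPr (sum_norm_fderiv_dbarChartField_apply_le_of_regPr)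

variable (F : T3Family) (n K : ℕ) (h : n ≤ K)
variable {n K}

/-- ★★★ **F0″ ∘ F2″ AT THE MEMBER**: the symmetric chart remainder `CmapTwS` of a printed-regular background is the `κ`-damped ℓ¹ sum of the one-step defects of its covariant log tower,
with the EXPLICIT, level-independent damping `κ = (L²)⁻¹ + 2·10¹⁵·L³·ε₀` (print's `L^{1−d} = L⁻²` at `ε₀ = 0`); windows `10⁹L²e ≤ 1`, `10¹³L³ε₀ ≤ 1`, `‖X‖ < e·η`.
[cite: Balaban1985Averaging, (125)-(127) p.36, (150)-(152) p.40; Balaban1985Variational, (44)-(46) p.285, (146) p.301; Balaban1984PropagatorsI, (1.18)-(1.20) pp.19-20] -/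
theorem l1_CmapTwS_le_damped_defects_of_regPr_damped {ε₀ e : ℝ} (he : 0 < e) (hWe : 10 ^ 9 * (F.L : ℝ) ^ 2 * e ≤ 1) (hWε : 10 ^ 13 * (F.L : ℝ) ^ 3 * ε₀ ≤ 1)
    (U₀ : GaugeField (F.P K) 0 (Matrix.specialUnitaryGroup (Fin 2) ℂ)) (hreg : RegPr F n K ε₀ U₀)
    (Fm : (m : ℕ) → (PBond (F.P K) 0 → Matrix (Fin 2) (Fin 2) ℂ) → (PBond (F.P K) m → Matrix (Fin 2) (Fin 2) ℂ)) (hF0 : ∀ x, Fm 0 x = x)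
    (hFs : ∀ (m : ℕ) (x : PBond (F.P K) 0 → Matrix (Fin 2) (Fin 2) ℂ), Fm (m + 1) x =
        (fun y : PBond (F.P K) m → Matrix (Fin 2) (Fin 2) ℂ => fun c : PBond (F.P K) (m + 1) =>
          mlog (((dbarCovU (emlIterU m (bgUnits F K U₀)) (fun b => expUnit (y b) * emlIterU m (bgUnits F K U₀) b) c : (Matrix (Fin 2) (Fin 2) ℂ)ˣ) : Matrix (Fin 2) (Fin 2) ℂ) *
            (((emlAvgU (emlIterU m (bgUnits F K U₀)) c)⁻¹ : (Matrix (Fin 2) (Fin 2) ℂ)ˣ) : Matrix (Fin 2) (Fin 2) ℂ))) (Fm m x))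
    (Lin : (m : ℕ) → (PBond (F.P K) 0 → Matrix (Fin 2) (Fin 2) ℂ) →L[ℂ] (PBond (F.P K) m → Matrix (Fin 2) (Fin 2) ℂ))
    (hLin0 : Lin 0 = ContinuousLinearMap.id ℂ (PBond (F.P K) 0 → Matrix (Fin 2) (Fin 2) ℂ))
    (hLins : ∀ m : ℕ, Lin (m + 1) =
        (fderiv ℂ (fun y : PBond (F.P K) m → Matrix (Fin 2) (Fin 2) ℂ => fun c : PBond (F.P K) (m + 1) =>
          mlog (((dbarCovU (emlIterU m (bgUnits F K U₀)) (fun b => expUnit (y b) * emlIterU m (bgUnits F K U₀) b) c : (Matrix (Fin 2) (Fin 2) ℂ)ˣ) : Matrix (Fin 2) (Fin 2) ℂ) *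
            (((emlAvgU (emlIterU m (bgUnits F K U₀)) c)⁻¹ : (Matrix (Fin 2) (Fin 2) ℂ)ˣ) : Matrix (Fin 2) (Fin 2) ℂ))) 0).comp (Lin m))
    (X : PBond (F.P K) 0 → Matrix (Fin 2) (Fin 2) ℂ) (hXr : ‖X‖ < e * eta F n K) :
    ∑ c : PBond (F.P n) 0, ‖CmapTwS F n K h U₀ X c‖ ≤
      ∑ l ∈ Finset.range (K - n), (((F.L : ℝ) ^ 2)⁻¹ + 2 * 10 ^ 15 * (F.L : ℝ) ^ 3 * ε₀) ^ (K - n - 1 - l) *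
        ∑ c', ‖((fun y : PBond (F.P K) l → Matrix (Fin 2) (Fin 2) ℂ => fun c : PBond (F.P K) (l + 1) =>
          mlog (((dbarCovU (emlIterU l (bgUnits F K U₀)) (fun b => expUnit (y b) * emlIterU l (bgUnits F K U₀) b) c : (Matrix (Fin 2) (Fin 2) ℂ)ˣ) : Matrix (Fin 2) (Fin 2) ℂ) *
            (((emlAvgU (emlIterU l (bgUnits F K U₀)) c)⁻¹ : (Matrix (Fin 2) (Fin 2) ℂ)ˣ) : Matrix (Fin 2) (Fin 2) ℂ))) (Fm l X) -
        fderiv ℂ (fun y : PBond (F.P K) l → Matrix (Fin 2) (Fin 2) ℂ => fun c : PBond (F.P K) (l + 1) =>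
          mlog (((dbarCovU (emlIterU l (bgUnits F K U₀)) (fun b => expUnit (y b) * emlIterU l (bgUnits F K U₀) b) c : (Matrix (Fin 2) (Fin 2) ℂ)ˣ) : Matrix (Fin 2) (Fin 2) ℂ) *
            (((emlAvgU (emlIterU l (bgUnits F K U₀)) c)⁻¹ : (Matrix (Fin 2) (Fin 2) ℂ)ˣ) : Matrix (Fin 2) (Fin 2) ℂ))) 0 (Fm l X)) c'‖ := by
  have hε₀ : 0 < ε₀ := pos_of_regPr F hreg
  have hL0 : (0 : ℝ) ≤ (F.L : ℝ) := Nat.cast_nonneg _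
  have hWε12 : 10 ^ 12 * (F.L : ℝ) ^ 3 * ε₀ ≤ 1 := by
    have h0 : (0 : ℝ) ≤ (F.L : ℝ) ^ 3 * ε₀ := by positivity
    nlinarith
  have hκ : (0 : ℝ) ≤ ((F.L : ℝ) ^ 2)⁻¹ + 2 * 10 ^ 15 * (F.L : ℝ) ^ 3 * ε₀ := by positivity
  exact l1_CmapTwS_le_damped_defects_of_regPr F n K h hε₀ he hWe hWε12 U₀ hreg Fm hF0 hFs Lin hLin0 hLins hκ
    (fun m hm v => sum_norm_fderiv_dbarChartField_apply_le_of_regPr (F := F) (n := n) (K := K) hWε hreg (by omega) v) X hXr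

/-- ★★★ **F0″ ∘ F1″ ∘ F2″ AT THE MEMBER**: the symmetric chart remainder `CmapTwS` of a printed-regular background is the `κ`-damped sum of the LEVEL MASSES of its covariant log tower
times px15 g3's one-step defect constant `10⁹L⁴`, with the explicit damping `κ = (L²)⁻¹ + 2·10¹⁵·L³·ε₀` (routeR-w6 g7's ✓`l1_CmapTwS_le_damped_levelMasses` with `hκ`∕`hT` discharged);
windows `10⁹L²e ≤ 1`, `10¹³L³ε₀ ≤ 1`, `‖X‖ < e·η`.
[cite: Balaban1985Averaging, (125)-(127) p.36, (150)-(152) p.40; Balaban1985Variational, (44)-(46) p.285, (146) p.301; Balaban1984PropagatorsI, (1.18)-(1.20) pp.19-20] -/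
theorem l1_CmapTwS_le_damped_levelMasses_damped {ε₀ e : ℝ} (he : 0 < e) (hWe : 10 ^ 9 * (F.L : ℝ) ^ 2 * e ≤ 1) (hWε : 10 ^ 13 * (F.L : ℝ) ^ 3 * ε₀ ≤ 1)
    (U₀ : GaugeField (F.P K) 0 (Matrix.specialUnitaryGroup (Fin 2) ℂ)) (hreg : RegPr F n K ε₀ U₀)
    (Fm : (m : ℕ) → (PBond (F.P K) 0 → Matrix (Fin 2) (Fin 2) ℂ) → (PBond (F.P K) m → Matrix (Fin 2) (Fin 2) ℂ)) (hF0 : ∀ x, Fm 0 x = x)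
    (hFs : ∀ (m : ℕ) (x : PBond (F.P K) 0 → Matrix (Fin 2) (Fin 2) ℂ), Fm (m + 1) x =
        (fun y : PBond (F.P K) m → Matrix (Fin 2) (Fin 2) ℂ => fun c : PBond (F.P K) (m + 1) =>
          mlog (((dbarCovU (emlIterU m (bgUnits F K U₀)) (fun b => expUnit (y b) * emlIterU m (bgUnits F K U₀) b) c : (Matrix (Fin 2) (Fin 2) ℂ)ˣ) : Matrix (Fin 2) (Fin 2) ℂ) *
            (((emlAvgU (emlIterU m (bgUnits F K U₀)) c)⁻¹ : (Matrix (Fin 2) (Fin 2) ℂ)ˣ) : Matrix (Fin 2) (Fin 2) ℂ))) (Fm m x))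
    (Lin : (m : ℕ) → (PBond (F.P K) 0 → Matrix (Fin 2) (Fin 2) ℂ) →L[ℂ] (PBond (F.P K) m → Matrix (Fin 2) (Fin 2) ℂ))
    (hLin0 : Lin 0 = ContinuousLinearMap.id ℂ (PBond (F.P K) 0 → Matrix (Fin 2) (Fin 2) ℂ))
    (hLins : ∀ m : ℕ, Lin (m + 1) =
        (fderiv ℂ (fun y : PBond (F.P K) m → Matrix (Fin 2) (Fin 2) ℂ => fun c : PBond (F.P K) (m + 1) =>
          mlog (((dbarCovU (emlIterU m (bgUnits F K U₀)) (fun b => expUnit (y b) * emlIterU m (bgUnits F K U₀) b) c : (Matrix (Fin 2) (Fin 2) ℂ)ˣ) : Matrix (Fin 2) (Fin 2) ℂ) *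
            (((emlAvgU (emlIterU m (bgUnits F K U₀)) c)⁻¹ : (Matrix (Fin 2) (Fin 2) ℂ)ˣ) : Matrix (Fin 2) (Fin 2) ℂ))) 0).comp (Lin m))
    (X : PBond (F.P K) 0 → Matrix (Fin 2) (Fin 2) ℂ) (hXr : ‖X‖ < e * eta F n K) :
    ∑ c : PBond (F.P n) 0, ‖CmapTwS F n K h U₀ X c‖ ≤
      ∑ l ∈ Finset.range (K - n), (((F.L : ℝ) ^ 2)⁻¹ + 2 * 10 ^ 15 * (F.L : ℝ) ^ 3 * ε₀) ^ (K - n - 1 - l) *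
        (10 ^ 9 * (F.L : ℝ) ^ 4 * ∑ b : PBond (F.P K) l, ‖Fm l X b‖ ^ 2) := by
  have hε₀ : 0 < ε₀ := pos_of_regPr F hreg
  have hL0 : (0 : ℝ) ≤ (F.L : ℝ) := Nat.cast_nonneg _
  have hWε12 : 10 ^ 12 * (F.L : ℝ) ^ 3 * ε₀ ≤ 1 := by
    have h0 : (0 : ℝ) ≤ (F.L : ℝ) ^ 3 * ε₀ := by positivity
    nlinarith
  have hκ : (0 : ℝ) ≤ ((F.L : ℝ) ^ 2)⁻¹ + 2 * 10 ^ 15 * (F.L : ℝ) ^ 3 * ε₀ := by positivity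
  exact l1_CmapTwS_le_damped_levelMasses F h hε₀ he hWe hWε12 U₀ hreg Fm hF0 hFs Lin hLin0 hLins hκ
    (fun m hm v => sum_norm_fderiv_dbarChartField_apply_le_of_regPr (F := F) (n := n) (K := K) hWε hreg (by omega) v) X hXr

end Summit.QuantumFields.YangMills.Theorems.Prop7CovLogTowerDampedOfRegPr

end
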